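import Literature.Probability.RandomPlanarGeometry.RadialBesselContinuity
import HarnessLib

/-!
# The radial Bessel process near the endpoints: short lifetime and boundary values of the exit functionals

Topic `Probability/RandomPlanarGeometry`; theorems only, sequel of `RadialBesselContinuity`. For
the SLE_κ radial Bessel process `Y = Y^θ` (LSW (2002), (2.9)–(2.11)), `κ > 4`, we prove that the
lifetime is short near the endpoints of `(0, 2π)` and deduce the boundary values of the exit
functionals `a_φ(θ) = E^θ[φ(T); Y_T = 2π]`, `b_φ(θ) = E^θ[φ(T); Y_T = 0]` (`φ` bounded continuous):

* `measureReal_lt_sleLifetime_le_of_lyapunov` — **Lyapunov bound** `P^θ[η < T] ≤ G(θ)/(c η)` for a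
  function `G ≥ 0`, `C²` on `(0, 2π)`, with `Λ₀ G ≤ -c` there (Dynkin's formula at the level exit
  times `σₙ`, `E[σₙ ∧ t] ≤ G(θ)/c` uniformly in `n`, and `{η < T} = ⋃ₙ {η < σₙ}`);
* the Lyapunov functions `y^p` and `(2π - y)^p`, `p = (1 - 4/κ)/2` (`expGenerator_rpow_le`,
  `expGenerator_rpow_two_pi_sub_le`: `Λ₀ y^p = p y^{p-2}((κ/2)(p-1) + y cot(y/2)) ≤ -(κ q/4) p (2π)^{p-2}`
  by `y cot(y/2) < 2`, the tree's `mul_cot_half_lt_two`), whence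
  `measureReal_lt_sleLifetime_le_rpow` and `…_two_pi_sub_rpow`: `P^θ[η < T] ≤ C θ^p/η`,
  `≤ C (2π - θ)^p/η`;
* **boundary values**: `tendsto_topExpect_nhdsGT_zero` (`a_φ(θ) → 0`),
  `tendsto_botExpect_nhdsGT_zero` (`b_φ(θ) → φ(0)`) as `θ ↓ 0`, and `tendsto_botExpect_nhdsLT_two_pi`
  (`b_φ → 0`), `tendsto_topExpect_nhdsLT_two_pi` (`a_φ → φ(0)`) as `θ ↑ 2π` (the exit side
  probabilities `(s(θ) - s(0))/(s(2π) - s(0))` tend to `0`/`1`, and `T → 0` in probability).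

These are the Dirichlet data of the renewal extension of LSW's hitting function at `θ = 0`
((2.3), here obtained from the diffusion rather than from RSW) and its value `u(t)` at `θ = 2π`.

## References

* G. F. Lawler, O. Schramm, W. Werner, *One-arm exponent for critical 2D percolation*, Electron.
  J. Probab. 7 (2002), no. 2, §2, (2.3) and proof of Lemma 2.2. [LawlerSchrammWernerEJP2002]
* G. F. Lawler, *Conformally Invariant Processes in the Plane*, AMS (2005), §1.11 (comparison with
  Bessel processes). [Lawler2005]
-/

noncomputable section

open MeasureTheory ProbabilityTheory Filter Topology Set
open scoped NNReal ENNReal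

namespace Literature.Probability.RandomPlanarGeometry

namespace RadialLoewner

open Literature.Probability.Process Literature.Analysis.FunctionSpaces
open Literature.Probability.Percolation (lswQ lswQ_pos lswQ_lt_one mul_cot_half_lt_two)

variable {κ : ℝ≥0} {n : ℕ} {θ : ℝ}

/-! ### The Lyapunov bound on the lifetime -/

/-- **`E[σₙ ∧ t] ≤ G(θ)/c` from a Lyapunov function**: if `G ∈ C²(ℝ)` is nonnegative on the
level-`n` interval and `Λ₀ G ≤ -c < 0` there, then Dynkin's formula at `σₙ` gives
`c E[σₙ ∧ t] ≤ G(θ) - E[G(Y_{t∧σₙ})] ≤ G(θ)`. [folklore] -/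
theorem integral_min_sleExitLevel_le_of_lyapunov (hθn : θ ∈ Ioo (2 * level n) (2 * Real.pi - 2 * level n))
    {G : ℝ → ℝ} (hG : ContDiff ℝ 2 G) {c : ℝ} (hc : 0 < c)
    (hG0 : ∀ y ∈ Icc (2 * level n) (2 * Real.pi - 2 * level n), 0 ≤ G y)
    (hGen : ∀ y ∈ Icc (2 * level n) (2 * Real.pi - 2 * level n), expGenerator κ 0 G y ≤ -c) (t : ℝ≥0) :
    ∫ ω, (((min (t : WithTop ℝ≥0) (sleExitLevel κ n θ ω)).untopA : ℝ≥0) : ℝ) ∂preWienerMeasure ≤ G θ / c := by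
  haveI := isProbabilityMeasure_preWienerMeasure'
  have hτ := isStoppingTime_sleExitLevel κ n θ
  have hτσ : ∀ ω, sleExitLevel κ n θ ω ≤ sleExitLevel κ n θ ω := fun ω ↦ le_rfl
  have hdyn := integral_apply_stoppedProcess_eq hθn hG hτ hτσ t
  have hIi := integrable_intervalIntegral_expGenerator hθn hG hτ hτσ t
  -- the generator term is `≤ -c (t ∧ σₙ)`
  have hup : ∀ ω, (∫ s in (0 : ℝ)..(((min (t : WithTop ℝ≥0) (sleExitLevel κ n θ ω)).untopA : ℝ≥0) : ℝ),
      expGenerator κ 0 G (sleArgLevel κ n θ s.toNNReal ω)) ≤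
      -c * (((min (t : WithTop ℝ≥0) (sleExitLevel κ n θ ω)).untopA : ℝ≥0) : ℝ) := by
    intro ω
    set r := (((min (t : WithTop ℝ≥0) (sleExitLevel κ n θ ω)).untopA : ℝ≥0) : ℝ) with hr
    have hr0 : 0 ≤ r := NNReal.coe_nonneg _
    have hle : ∀ s ∈ Icc 0 r, expGenerator κ 0 G (sleArgLevel κ n θ s.toNNReal ω) ≤ -c := by
      intro s hs
      have hsσ : ((s.toNNReal : ℝ≥0) : WithTop ℝ≥0) ≤ sleExitLevel κ n θ ω :=
        (WithTop.coe_le_coe.2 ((Real.toNNReal_le_iff_le_coe).2 hs.2)).trans (coe_untopA_min_le _ _)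
      exact hGen _ (argTrunc_mem_Icc_of_le_truncExit _ (level_pos n) (level_le n) hθn ω hsσ)
    have hcont : ContinuousOn (fun s ↦ expGenerator κ 0 G (sleArgLevel κ n θ s.toNNReal ω)) (Icc 0 r) := by
      have hc1 : Continuous fun s : ℝ ↦ sleArgLevel κ n θ s.toNNReal ω :=
        (continuous_sleArgLevel κ n θ ω).comp continuous_real_toNNReal
      refine (continuousOn_expGenerator κ 0 hG).comp hc1.continuousOn fun s hs ↦ ?_
      have hsσ : ((s.toNNReal : ℝ≥0) : WithTop ℝ≥0) ≤ sleExitLevel κ n θ ω :=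
        (WithTop.coe_le_coe.2 ((Real.toNNReal_le_iff_le_coe).2 hs.2)).trans (coe_untopA_min_le _ _)
      exact Icc_level_subset_Ioo n (argTrunc_mem_Icc_of_le_truncExit _ (level_pos n) (level_le n) hθn ω hsσ)
    have hmono := intervalIntegral.integral_mono_on hr0 (hcont.intervalIntegrable_of_Icc hr0)
      (intervalIntegrable_const (μ := volume) (c := -c)) (fun s hs ↦ hle s hs)
    rw [intervalIntegral.integral_const, smul_eq_mul, sub_zero] at hmono
    linarith
  -- the left side of Dynkin is `≥ 0`
  have hlow : 0 ≤ ∫ ω, G (stoppedProcess (sleArgLevel κ n θ) (sleExitLevel κ n θ) t ω) ∂preWienerMeasure :=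
    integral_nonneg fun ω ↦ hG0 _ (stoppedProcess_sleArgLevel_mem_Icc hθn t ω)
  have hmeasr : Measurable fun ω ↦ (((min (t : WithTop ℝ≥0) (sleExitLevel κ n θ ω)).untopA : ℝ≥0) : ℝ) := by
    have h := ((isStoppingTime_const brownianFiltration t).min hτ).measurable'.untopA.coe_nnreal_real
    exact h
  have hri : Integrable (fun ω ↦ (((min (t : WithTop ℝ≥0) (sleExitLevel κ n θ ω)).untopA : ℝ≥0) : ℝ))
      preWienerMeasure := by
    refine integrable_of_abs_le hmeasr (C := t) fun ω ↦ ?_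
    rw [abs_of_nonneg (NNReal.coe_nonneg _)]
    exact_mod_cast untopA_min_coe_le t _
  have hmono := integral_mono hIi (hri.const_mul (-c)) hup
  rw [integral_const_mul] at hmono
  rw [le_div_iff₀ hc]
  linarith

/-- If `η < σ` then `η ≤ (σ ∧ (η + 1))` read in `ℝ≥0`. [folklore] -/
theorem le_untopA_min_of_lt {η : ℝ≥0} {σ : WithTop ℝ≥0} (h : (η : WithTop ℝ≥0) < σ) :
    η ≤ (min ((η + 1 : ℝ≥0) : WithTop ℝ≥0) σ).untopA := by
  induction σ using WithTop.recTopCoe with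
  | top => rw [untopA_min_coe_top]; exact le_self_add
  | coe s => rw [untopA_min_coe_coe]; exact le_min le_self_add (WithTop.coe_lt_coe.1 h).le

/-- **`P^θ[η < T] ≤ G(θ)/(c η)` from a Lyapunov function** `G ≥ 0`, `C²` on `(0, 2π)` with
`Λ₀ G ≤ -c` there (`θ ∈ (0, 2π)`): Markov's inequality for `σₙ ∧ (η + 1)` and
`{η < T} = ⋃ₙ {η < σₙ}`. [folklore] -/
theorem measureReal_lt_sleLifetime_le_of_lyapunov (hθ : θ ∈ Ioo 0 (2 * Real.pi))
    {G : ℝ → ℝ} (hG : ContDiffOn ℝ 2 G (Ioo 0 (2 * Real.pi))) {c : ℝ} (hc : 0 < c)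
    (hG0 : ∀ y ∈ Ioo 0 (2 * Real.pi), 0 ≤ G y)
    (hGen : ∀ y ∈ Ioo 0 (2 * Real.pi), expGenerator κ 0 G y ≤ -c) {η : ℝ≥0} (hη : 0 < η) :
    preWienerMeasure.real {ω | (η : WithTop ℝ≥0) < sleLifetime κ θ ω} ≤ G θ / (c * η) := by
  haveI := isProbabilityMeasure_preWienerMeasure'
  have hGθ : 0 ≤ G θ := hG0 θ hθ
  have hK0 : 0 ≤ G θ / (c * η) := by positivity
  set A : ℕ → Set (ℝ≥0 → ℝ) := fun n ↦ {ω | (η : WithTop ℝ≥0) < sleExitLevel κ n θ ω} with hA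
  have hmono : Monotone A := fun n m hnm ω (hω : (η : WithTop ℝ≥0) < _) ↦
    hω.trans_le (exitLevel_mono (continuous_sleDriving' κ) θ ω hnm)
  have hbound : ∀ n, preWienerMeasure.real (A n) ≤ G θ / (c * η) := by
    intro n
    by_cases hθn : θ ∈ Ioo (2 * level n) (2 * Real.pi - 2 * level n)
    · -- a global `C²` version of `G` near the level interval
      obtain ⟨F, hF, hFeq⟩ := exists_contDiff_eventuallyEq hG (level_pos n) (level_lt_pi n)
      have hFval : ∀ y ∈ Icc (2 * level n) (2 * Real.pi - 2 * level n), F y = G y := fun y hy ↦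
        (hFeq y (Icc_level_subset_Ioo_level n hy)).eq_of_nhds
      have hF0 : ∀ y ∈ Icc (2 * level n) (2 * Real.pi - 2 * level n), 0 ≤ F y := fun y hy ↦ by
        rw [hFval y hy]; exact hG0 y (Icc_level_subset_Ioo n hy)
      have hFgen : ∀ y ∈ Icc (2 * level n) (2 * Real.pi - 2 * level n), expGenerator κ 0 F y ≤ -c := fun y hy ↦ by
        rw [expGenerator_congr (hFeq y (Icc_level_subset_Ioo_level n hy))]
        exact hGen y (Icc_level_subset_Ioo n hy)
      have hE := integral_min_sleExitLevel_le_of_lyapunov hθn hF hc hF0 hFgen (η + 1)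
      rw [hFval θ ⟨hθn.1.le, hθn.2.le⟩] at hE
      -- Markov
      set m : (ℝ≥0 → ℝ) → ℝ := fun ω ↦ (((min ((η + 1 : ℝ≥0) : WithTop ℝ≥0) (sleExitLevel κ n θ ω)).untopA : ℝ≥0) : ℝ)
        with hm
      have hmm : Measurable m := by
        have h := ((isStoppingTime_const brownianFiltration (η + 1)).min
          (isStoppingTime_sleExitLevel κ n θ)).measurable'.untopA.coe_nnreal_real
        exact h
      have hmi : Integrable m preWienerMeasure := by
        refine integrable_of_abs_le hmm (C := (η : ℝ) + 1) fun ω ↦ ?_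
        rw [abs_of_nonneg (NNReal.coe_nonneg _)]
        exact_mod_cast untopA_min_coe_le (η + 1) _
      have hsub : A n ⊆ {ω | (η : ℝ) ≤ m ω} := by
        intro ω (hω : (η : WithTop ℝ≥0) < sleExitLevel κ n θ ω)
        show (η : ℝ) ≤ (((min ((η + 1 : ℝ≥0) : WithTop ℝ≥0) (sleExitLevel κ n θ ω)).untopA : ℝ≥0) : ℝ)
        exact_mod_cast le_untopA_min_of_lt hω
      have hmk := mul_meas_ge_le_integral_of_nonneg (μ := preWienerMeasure)
        (Eventually.of_forall fun ω ↦ (NNReal.coe_nonneg _ : 0 ≤ m ω)) hmi η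
      calc preWienerMeasure.real (A n) ≤ preWienerMeasure.real {ω | (η : ℝ) ≤ m ω} := measureReal_mono hsub
        _ ≤ (∫ ω, m ω ∂preWienerMeasure) / η := by rw [le_div_iff₀ (by exact_mod_cast hη), mul_comm]; exact hmk
        _ ≤ (G θ / c) / η := div_le_div_of_nonneg_right hE (NNReal.coe_nonneg η)
        _ = G θ / (c * η) := by rw [div_div]
    · have hempty : A n = ∅ := by
        refine eq_empty_of_forall_notMem fun ω (hω : (η : WithTop ℝ≥0) < _) ↦ ?_
        have h0 : sleExitLevel κ n θ ω = 0 := exitLevel_eq_zero_of_not_mem (continuous_sleDriving' κ) hθn ω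
        rw [h0] at hω
        exact not_lt_bot hω
      rw [hempty, measureReal_empty]; exact hK0
  have hbound' : ∀ n, preWienerMeasure (A n) ≤ ENNReal.ofReal (G θ / (c * η)) := fun n ↦ by
    rw [← ofReal_measureReal (measure_ne_top _ _)]
    exact ENNReal.ofReal_le_ofReal (hbound n)
  have hunion : preWienerMeasure (⋃ n, A n) ≤ ENNReal.ofReal (G θ / (c * η)) := by
    rw [hmono.measure_iUnion]
    exact iSup_le hbound'
  rw [setOf_lt_sleLifetime_eq_iUnion]
  exact ENNReal.toReal_le_of_le_ofReal hK0 hunion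

/-! ### The Lyapunov functions `y^p` and `(2π - y)^p` -/

/-- The exponent `p = (1 - 4/κ)/2 ∈ (0, 1/2)` (`κ > 4`). [folklore] -/
def lyapExp (κ : ℝ≥0) : ℝ := lswQ κ / 2

/-- `0 < p`. [folklore] -/
theorem lyapExp_pos (hκ : 4 < κ) : 0 < lyapExp κ :=
  half_pos (lswQ_pos (by exact_mod_cast hκ))

/-- `p < 1`. [folklore] -/
theorem lyapExp_lt_one (hκ : 4 < κ) : lyapExp κ < 1 := by
  have := lswQ_lt_one (κ := (κ : ℝ)) (by exact_mod_cast hκ)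
  rw [lyapExp]; linarith

/-- `(κ/2)(p - 1) + 2 = -κ q/4` with `q = 1 - 4/κ`, `p = q/2`. [folklore] -/
theorem lyapExp_identity (hκ : 4 < κ) : (κ : ℝ) / 2 * (lyapExp κ - 1) + 2 = -(κ * lswQ κ / 4) := by
  have hκ0 : (κ : ℝ) ≠ 0 := by
    have : (4 : ℝ) < κ := by exact_mod_cast hκ
    linarith
  rw [lyapExp, lswQ]
  field_simp
  ring

/-- The Lyapunov constant `c = p κ q/4 · (2π)^{p-2} > 0`. [folklore] -/
def lyapConst (κ : ℝ≥0) : ℝ := lyapExp κ * (κ * lswQ κ / 4) * (2 * Real.pi) ^ (lyapExp κ - 2)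

/-- `c > 0`. [folklore] -/
theorem lyapConst_pos (hκ : 4 < κ) : 0 < lyapConst κ := by
  have hp := lyapExp_pos hκ
  have hq := lswQ_pos (κ := (κ : ℝ)) (by exact_mod_cast hκ)
  have hκ0 : (0 : ℝ) < κ := lt_trans (by norm_num) (show (4 : ℝ) < κ by exact_mod_cast hκ)
  unfold lyapConst
  have : 0 < (2 * Real.pi) ^ (lyapExp κ - 2) := Real.rpow_pos_of_pos (by positivity) _
  positivity

/-- **`Λ₀ y^p = p y^{p-2} ((κ/2)(p-1) + y cot(y/2))`** for `y > 0` with `sin(y/2) ≠ 0` irrelevant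
(pointwise calculus of `rpow`). [folklore] -/
theorem expGenerator_rpow {p y : ℝ} (hy : 0 < y) :
    expGenerator κ 0 (fun y : ℝ ↦ y ^ p) y = p * y ^ (p - 2) * ((κ : ℝ) / 2 * (p - 1) + y * Real.cot (y / 2)) := by
  have h1 : ∀ z : ℝ, 0 < z → HasDerivAt (fun y : ℝ ↦ y ^ p) (p * z ^ (p - 1)) z := fun z hz ↦
    Real.hasDerivAt_rpow_const (Or.inl hz.ne')
  have hd1 : deriv (fun y : ℝ ↦ y ^ p) =ᶠ[𝓝 y] fun z ↦ p * z ^ (p - 1) := by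
    filter_upwards [Ioi_mem_nhds hy] with z hz
    exact (h1 z hz).deriv
  have h2 : HasDerivAt (fun z : ℝ ↦ p * z ^ (p - 1)) (p * ((p - 1) * y ^ (p - 1 - 1))) y :=
    (Real.hasDerivAt_rpow_const (Or.inl hy.ne')).const_mul p
  rw [expGenerator_apply, iteratedDeriv_succ, iteratedDeriv_one, hd1.deriv_eq, h2.deriv, (h1 y hy).deriv,
    zero_mul, add_zero]
  have hy2 : y ^ (p - 1) = y ^ (p - 2) * y := by
    rw [show p - 1 = (p - 2) + 1 by ring, Real.rpow_add hy, Real.rpow_one]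
  have hy3 : y ^ (p - 1 - 1) = y ^ (p - 2) := by rw [show p - 1 - 1 = p - 2 by ring]
  rw [hy2, hy3]
  ring

/-- **`Λ₀ y^p ≤ -c`** on `(0, 2π)` for `p = lyapExp κ`, `c = lyapConst κ` (`κ > 4`; uses
`y cot(y/2) < 2`). [folklore] -/
theorem expGenerator_rpow_le (hκ : 4 < κ) {y : ℝ} (hy : y ∈ Ioo 0 (2 * Real.pi)) :
    expGenerator κ 0 (fun y : ℝ ↦ y ^ lyapExp κ) y ≤ -lyapConst κ := by
  have hp := lyapExp_pos hκ
  have hq := lswQ_pos (κ := (κ : ℝ)) (by exact_mod_cast hκ)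
  have hκ0 : (0 : ℝ) < κ := lt_trans (by norm_num) (show (4 : ℝ) < κ by exact_mod_cast hκ)
  rw [expGenerator_rpow hy.1]
  have hcot := mul_cot_half_lt_two hy.1 hy.2
  have hid := lyapExp_identity hκ
  have hbr : (κ : ℝ) / 2 * (lyapExp κ - 1) + y * Real.cot (y / 2) ≤ -(κ * lswQ κ / 4) := by linarith
  have hpow : (2 * Real.pi) ^ (lyapExp κ - 2) ≤ y ^ (lyapExp κ - 2) :=
    Real.rpow_le_rpow_of_nonpos hy.1 hy.2.le (by have := lyapExp_lt_one hκ; linarith)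
  have hypos : 0 < y ^ (lyapExp κ - 2) := Real.rpow_pos_of_pos hy.1 _
  unfold lyapConst
  -- `p y^{p-2} B ≤ p y^{p-2} (-κq/4) ≤ p (2π)^{p-2} (-κq/4)`
  calc lyapExp κ * y ^ (lyapExp κ - 2) * ((κ : ℝ) / 2 * (lyapExp κ - 1) + y * Real.cot (y / 2))
      ≤ lyapExp κ * y ^ (lyapExp κ - 2) * (-(κ * lswQ κ / 4)) :=
        mul_le_mul_of_nonneg_left hbr (by positivity)
    _ ≤ lyapExp κ * (2 * Real.pi) ^ (lyapExp κ - 2) * (-(κ * lswQ κ / 4)) := by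
        have : 0 ≤ κ * lswQ κ / 4 := by positivity
        nlinarith [mul_le_mul_of_nonneg_left hpow hp.le]
    _ = -(lyapExp κ * (κ * lswQ κ / 4) * (2 * Real.pi) ^ (lyapExp κ - 2)) := by ring

/-- `y^p` is `C²` on `(0, 2π)`. [folklore] -/
theorem contDiffOn_rpow_Ioo (p : ℝ) : ContDiffOn ℝ 2 (fun y : ℝ ↦ y ^ p) (Ioo 0 (2 * Real.pi)) :=
  fun _ hy ↦ (Real.contDiffAt_rpow_const_of_ne (p := p) hy.1.ne').contDiffWithinAt

/-- `(2π - y)^p` is `C²` on `(0, 2π)`. [folklore] -/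
theorem contDiffOn_two_pi_sub_rpow_Ioo (p : ℝ) :
    ContDiffOn ℝ 2 (fun y : ℝ ↦ (2 * Real.pi - y) ^ p) (Ioo 0 (2 * Real.pi)) := fun y hy ↦
  ((Real.contDiffAt_rpow_const_of_ne (p := p) (by linarith [hy.2] : 2 * Real.pi - y ≠ 0)).comp y
    (contDiffAt_const.sub contDiffAt_id)).contDiffWithinAt

/-- **`Λ₀ (2π - y)^p`** in terms of `Λ₀ y^p` at the reflected point: with `g(y) = f(2π - y)`,
`g' = -f'`, `g'' = f''` and `cot(y/2) = -cot((2π - y)/2)`, so `Λ₀ g (y) = Λ₀ f (2π - y)`. [folklore] -/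
theorem expGenerator_two_pi_sub_rpow {p y : ℝ} (hy : y ∈ Ioo 0 (2 * Real.pi)) :
    expGenerator κ 0 (fun y : ℝ ↦ (2 * Real.pi - y) ^ p) y =
      expGenerator κ 0 (fun y : ℝ ↦ y ^ p) (2 * Real.pi - y) := by
  have hz : 0 < 2 * Real.pi - y := by linarith [hy.2]
  -- derivatives of the reflected power
  have h1 : ∀ z : ℝ, z < 2 * Real.pi → HasDerivAt (fun y : ℝ ↦ (2 * Real.pi - y) ^ p)
      (p * (2 * Real.pi - z) ^ (p - 1) * (0 - 1)) z := fun z hz' ↦ by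
    have hne : 2 * Real.pi - z ≠ 0 := by linarith
    have h := (Real.hasDerivAt_rpow_const (p := p) (Or.inl hne)).comp z
      ((hasDerivAt_const z (2 * Real.pi)).sub (hasDerivAt_id z))
    exact h
  have hd1 : deriv (fun y : ℝ ↦ (2 * Real.pi - y) ^ p) =ᶠ[𝓝 y]
      fun z ↦ p * (2 * Real.pi - z) ^ (p - 1) * (0 - 1) := by
    filter_upwards [Iio_mem_nhds hy.2] with z hz'
    exact (h1 z hz').deriv
  have h2 : HasDerivAt (fun z : ℝ ↦ p * (2 * Real.pi - z) ^ (p - 1) * (0 - 1))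
      (p * ((p - 1) * (2 * Real.pi - y) ^ (p - 1 - 1) * (0 - 1)) * (0 - 1)) y := by
    have hg : HasDerivAt (fun z : ℝ ↦ (2 * Real.pi - z) ^ (p - 1))
        ((p - 1) * (2 * Real.pi - y) ^ (p - 1 - 1) * (0 - 1)) y :=
      (Real.hasDerivAt_rpow_const (p := p - 1) (Or.inl hz.ne')).comp y
        ((hasDerivAt_const y (2 * Real.pi)).sub (hasDerivAt_id y))
    exact (hg.const_mul p).mul_const (0 - 1)
  -- derivatives of the power at the reflected point
  have h3 : ∀ w : ℝ, 0 < w → HasDerivAt (fun y : ℝ ↦ y ^ p) (p * w ^ (p - 1)) w := fun w hw ↦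
    Real.hasDerivAt_rpow_const (Or.inl hw.ne')
  have hd3 : deriv (fun y : ℝ ↦ y ^ p) =ᶠ[𝓝 (2 * Real.pi - y)] fun w ↦ p * w ^ (p - 1) := by
    filter_upwards [Ioi_mem_nhds hz] with w hw
    exact (h3 w hw).deriv
  have h4 : HasDerivAt (fun w : ℝ ↦ p * w ^ (p - 1)) (p * ((p - 1) * (2 * Real.pi - y) ^ (p - 1 - 1))) (2 * Real.pi - y) :=
    (Real.hasDerivAt_rpow_const (Or.inl hz.ne')).const_mul p
  rw [expGenerator_apply, expGenerator_apply, iteratedDeriv_succ, iteratedDeriv_one, iteratedDeriv_succ,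
    iteratedDeriv_one, hd1.deriv_eq, h2.deriv, (h1 y hy.2).deriv, hd3.deriv_eq, h4.deriv, (h3 _ hz).deriv]
  have hcot : Real.cot ((2 * Real.pi - y) / 2) = -Real.cot (y / 2) := by
    rw [show (2 * Real.pi - y) / 2 = Real.pi - y / 2 by ring, Real.cot_eq_cos_div_sin, Real.cot_eq_cos_div_sin,
      Real.cos_pi_sub, Real.sin_pi_sub]
    ring
  rw [hcot]
  ring

/-- **`Λ₀ (2π - y)^p ≤ -c`** on `(0, 2π)`. [folklore] -/
theorem expGenerator_two_pi_sub_rpow_le (hκ : 4 < κ) {y : ℝ} (hy : y ∈ Ioo 0 (2 * Real.pi)) :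
    expGenerator κ 0 (fun y : ℝ ↦ (2 * Real.pi - y) ^ lyapExp κ) y ≤ -lyapConst κ := by
  rw [expGenerator_two_pi_sub_rpow hy]
  exact expGenerator_rpow_le hκ ⟨by linarith [hy.2], by linarith [hy.1]⟩

/-- **Short lifetime near `0`**: `P^θ[η < T] ≤ θ^p / (c η)` (`θ ∈ (0, 2π)`, `κ > 4`). [folklore] -/
theorem measureReal_lt_sleLifetime_le_rpow (hκ : 4 < κ) (hθ : θ ∈ Ioo 0 (2 * Real.pi)) {η : ℝ≥0}
    (hη : 0 < η) :
    preWienerMeasure.real {ω | (η : WithTop ℝ≥0) < sleLifetime κ θ ω} ≤ θ ^ lyapExp κ / (lyapConst κ * η) :=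
  measureReal_lt_sleLifetime_le_of_lyapunov hθ (contDiffOn_rpow_Ioo _) (lyapConst_pos hκ)
    (fun _ hy ↦ (Real.rpow_pos_of_pos hy.1 _).le) (fun _ hy ↦ expGenerator_rpow_le hκ hy) hη

/-- **Short lifetime near `2π`**: `P^θ[η < T] ≤ (2π - θ)^p / (c η)`. [folklore] -/
theorem measureReal_lt_sleLifetime_le_two_pi_sub_rpow (hκ : 4 < κ) (hθ : θ ∈ Ioo 0 (2 * Real.pi))
    {η : ℝ≥0} (hη : 0 < η) :
    preWienerMeasure.real {ω | (η : WithTop ℝ≥0) < sleLifetime κ θ ω} ≤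
      (2 * Real.pi - θ) ^ lyapExp κ / (lyapConst κ * η) :=
  measureReal_lt_sleLifetime_le_of_lyapunov hθ (contDiffOn_two_pi_sub_rpow_Ioo _) (lyapConst_pos hκ)
    (fun y hy ↦ (Real.rpow_pos_of_pos (by linarith [hy.2]) _).le)
    (fun y hy ↦ expGenerator_two_pi_sub_rpow_le hκ hy) hη

/-! ### Boundary values of the exit functionals -/

section BoundaryValues

variable (hκ : 4 < κ)
include hκ

/-- `(0, 2π)` is a right neighbourhood of `0`. [folklore] -/
theorem Ioo_mem_nhdsGT_zero : Ioo 0 (2 * Real.pi) ∈ 𝓝[>] (0 : ℝ) :=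
  Ioo_mem_nhdsGT (by have := hκ; positivity)

/-- `(0, 2π)` is a left neighbourhood of `2π`. [folklore] -/
theorem Ioo_mem_nhdsLT_two_pi : Ioo 0 (2 * Real.pi) ∈ 𝓝[<] (2 * Real.pi) :=
  Ioo_mem_nhdsLT (by have := hκ; positivity)

/-- **`P^θ[Y_T = 2π] → 0` as `θ ↓ 0`** (`= (s(θ) - s(0))/(s(2π) - s(0))`, `s` continuous). [folklore] -/
theorem tendsto_measureReal_sleExitsTop_nhdsGT_zero :
    Tendsto (fun θ ↦ preWienerMeasure.real (sleExitsTop κ θ)) (𝓝[>] 0) (𝓝 0) := by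
  have h2π : (0 : ℝ) < 2 * Real.pi := by positivity
  have hs : ContinuousWithinAt (sleScale κ) (Icc 0 (2 * Real.pi)) 0 := continuousOn_sleScale hκ 0 ⟨le_rfl, h2π.le⟩
  have hle : 𝓝[>] (0 : ℝ) ≤ 𝓝[Icc 0 (2 * Real.pi)] 0 :=
    nhdsWithin_le_iff.2 (mem_of_superset (Ioo_mem_nhdsGT_zero hκ) Ioo_subset_Icc_self)
  have hs' : Tendsto (sleScale κ) (𝓝[>] 0) (𝓝 (sleScale κ 0)) := hs.tendsto.mono_left hle
  have hlim : Tendsto (fun θ ↦ (sleScale κ θ - sleScale κ 0) / (sleScale κ (2 * Real.pi) - sleScale κ 0))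
      (𝓝[>] 0) (𝓝 0) := by
    have h := (hs'.sub_const (sleScale κ 0)).div_const (sleScale κ (2 * Real.pi) - sleScale κ 0)
    rwa [sub_self, zero_div] at h
  refine hlim.congr' ?_
  filter_upwards [Ioo_mem_nhdsGT_zero hκ] with θ hθ
  exact (measureReal_sleExitsTop_eq hκ hθ).symm

/-- **`P^θ[Y_T = 0] → 0` as `θ ↑ 2π`.** [folklore] -/
theorem tendsto_measureReal_sleExitsBot_nhdsLT_two_pi :
    Tendsto (fun θ ↦ preWienerMeasure.real (sleExitsBot κ θ)) (𝓝[<] (2 * Real.pi)) (𝓝 0) := by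
  have h2π : (0 : ℝ) < 2 * Real.pi := by positivity
  have hs : ContinuousWithinAt (sleScale κ) (Icc 0 (2 * Real.pi)) (2 * Real.pi) :=
    continuousOn_sleScale hκ _ ⟨h2π.le, le_rfl⟩
  have hle : 𝓝[<] (2 * Real.pi) ≤ 𝓝[Icc 0 (2 * Real.pi)] (2 * Real.pi) :=
    nhdsWithin_le_iff.2 (mem_of_superset (Ioo_mem_nhdsLT_two_pi hκ) Ioo_subset_Icc_self)
  have hs' : Tendsto (sleScale κ) (𝓝[<] (2 * Real.pi)) (𝓝 (sleScale κ (2 * Real.pi))) := hs.tendsto.mono_left hle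
  have hD : sleScale κ (2 * Real.pi) - sleScale κ 0 ≠ 0 :=
    (sub_pos.2 (strictMonoOn_sleScale hκ ⟨le_rfl, h2π.le⟩ ⟨h2π.le, le_rfl⟩ h2π)).ne'
  have hlim : Tendsto (fun θ ↦ 1 - (sleScale κ θ - sleScale κ 0) / (sleScale κ (2 * Real.pi) - sleScale κ 0))
      (𝓝[<] (2 * Real.pi)) (𝓝 0) := by
    have h := (hs'.sub_const (sleScale κ 0)).div_const (sleScale κ (2 * Real.pi) - sleScale κ 0)
    rw [div_self hD] at h
    have h2 := h.const_sub 1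
    rwa [sub_self] at h2
  refine hlim.congr' ?_
  filter_upwards [Ioo_mem_nhdsLT_two_pi hκ] with θ hθ
  have h := measureReal_sleExitsTop_add_sleExitsBot hκ hθ
  rw [← measureReal_sleExitsTop_eq hκ hθ]
  linarith

omit hκ in
/-- `|E[φ(T); S]| ≤ C P[S]` for `|φ| ≤ C`. [folklore] -/
theorem abs_integral_indicator_comp_le {S : Set (ℝ≥0 → ℝ)} (hS : MeasurableSet S) {φ : ℝ → ℝ} {C : ℝ}
    (hφb : ∀ t, |φ t| ≤ C) (θ : ℝ) :
    |∫ ω, S.indicator (fun ω ↦ φ (sleLifetimeReal κ θ ω)) ω ∂preWienerMeasure| ≤ C * preWienerMeasure.real S := by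
  haveI := isProbabilityMeasure_preWienerMeasure'
  have hC : 0 ≤ C := (abs_nonneg _).trans (hφb 0)
  calc |∫ ω, S.indicator (fun ω ↦ φ (sleLifetimeReal κ θ ω)) ω ∂preWienerMeasure|
      ≤ ∫ ω, |S.indicator (fun ω ↦ φ (sleLifetimeReal κ θ ω)) ω| ∂preWienerMeasure := abs_integral_le_integral_abs
    _ ≤ ∫ ω, S.indicator (fun _ ↦ C) ω ∂preWienerMeasure := by
        refine integral_mono_of_nonneg (Eventually.of_forall fun _ ↦ abs_nonneg _)
          ((integrable_const C).indicator hS) (Eventually.of_forall fun ω ↦ ?_)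
        by_cases hω : ω ∈ S
        · simp only [indicator_of_mem hω]; exact hφb _
        · simp only [indicator_of_notMem hω, abs_zero]; exact le_rfl
    _ = C * preWienerMeasure.real S := by
        rw [integral_indicator_const _ hS, smul_eq_mul, mul_comm]

omit hκ in
/-- **Oscillation at a short lifetime**: if `|φ(t) - φ(0)| ≤ w` for `t ∈ [0, η]` and `|φ| ≤ C`, then
`E|φ(T) - φ(0)| ≤ w + 2C P[η < T]`. [folklore] -/
theorem integral_abs_comp_sub_apply_zero_le {φ : ℝ → ℝ} {C : ℝ} (hφb : ∀ t, |φ t| ≤ C)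
    {η : ℝ≥0} {w : ℝ} (hw0 : 0 ≤ w) (hw : ∀ t ∈ Icc (0 : ℝ) η, |φ t - φ 0| ≤ w) (θ : ℝ) :
    ∫ ω, |φ (sleLifetimeReal κ θ ω) - φ 0| ∂preWienerMeasure ≤
      w + 2 * C * preWienerMeasure.real {ω | (η : WithTop ℝ≥0) < sleLifetime κ θ ω} := by
  haveI := isProbabilityMeasure_preWienerMeasure'
  have hC : 0 ≤ C := (abs_nonneg _).trans (hφb 0)
  set E : Set (ℝ≥0 → ℝ) := {ω | (η : WithTop ℝ≥0) < sleLifetime κ θ ω} with hE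
  have hEm : MeasurableSet E := measurableSet_lt measurable_const (measurable_sleLifetime κ θ)
  have hpt : ∀ ω, |φ (sleLifetimeReal κ θ ω) - φ 0| ≤ w + E.indicator (fun _ ↦ 2 * C) ω := by
    intro ω
    by_cases hω : ω ∈ E
    · rw [indicator_of_mem hω]
      have := (abs_sub _ _).trans (add_le_add (hφb (sleLifetimeReal κ θ ω)) (hφb 0))
      linarith
    · rw [indicator_of_notMem hω, add_zero]
      have hT : sleLifetime κ θ ω ≤ (η : WithTop ℝ≥0) := not_lt.1 hω
      obtain ⟨t, ht⟩ := WithTop.ne_top_iff_exists.1 (ne_top_of_le_ne_top WithTop.coe_ne_top hT)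
      rw [← ht, WithTop.coe_le_coe] at hT
      refine hw _ ⟨sleLifetimeReal_nonneg κ θ ω, ?_⟩
      rw [sleLifetimeReal_of_eq_coe ht.symm]
      exact_mod_cast hT
  calc ∫ ω, |φ (sleLifetimeReal κ θ ω) - φ 0| ∂preWienerMeasure
      ≤ ∫ ω, (w + E.indicator (fun _ ↦ 2 * C) ω) ∂preWienerMeasure := by
        refine integral_mono_of_nonneg (Eventually.of_forall fun _ ↦ abs_nonneg _)
          ((integrable_const w).add ((integrable_const (2 * C)).indicator hEm)) (Eventually.of_forall hpt)
    _ = w + 2 * C * preWienerMeasure.real E := by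
        rw [integral_add (integrable_const w) ((integrable_const (2 * C)).indicator hEm), integral_const,
          smul_eq_mul, probReal_univ, one_mul, integral_indicator_const _ hEm, smul_eq_mul, mul_comm]

omit hκ in
/-- **The deviation of `E[φ(T); S]` from `φ(0)`**: `|E[φ(T); S] - φ(0)| ≤ E|φ(T) - φ(0)| + |φ(0)| (1 - P[S])`.
[folklore] -/
theorem abs_integral_indicator_comp_sub_le {S : Set (ℝ≥0 → ℝ)} (hS : MeasurableSet S) {φ : ℝ → ℝ}
    (hφm : Measurable φ) {C : ℝ} (hφb : ∀ t, |φ t| ≤ C) (θ : ℝ) :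
    |(∫ ω, S.indicator (fun ω ↦ φ (sleLifetimeReal κ θ ω)) ω ∂preWienerMeasure) - φ 0| ≤
      (∫ ω, |φ (sleLifetimeReal κ θ ω) - φ 0| ∂preWienerMeasure) + |φ 0| * (1 - preWienerMeasure.real S) := by
  haveI := isProbabilityMeasure_preWienerMeasure'
  have hC : 0 ≤ C := (abs_nonneg _).trans (hφb 0)
  have hmT := measurable_sleLifetimeReal κ θ
  have hmeas : Measurable fun ω ↦ φ (sleLifetimeReal κ θ ω) - φ 0 := (hφm.comp hmT).sub measurable_const
  have hbd : ∀ ω, |φ (sleLifetimeReal κ θ ω) - φ 0| ≤ 2 * C := fun ω ↦ by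
    have := (abs_sub _ _).trans (add_le_add (hφb (sleLifetimeReal κ θ ω)) (hφb 0)); linarith
  have hi0 : Integrable (fun ω ↦ φ (sleLifetimeReal κ θ ω) - φ 0) preWienerMeasure := integrable_of_abs_le hmeas hbd
  have hi1 : Integrable (fun ω ↦ S.indicator (fun ω ↦ φ (sleLifetimeReal κ θ ω) - φ 0) ω) preWienerMeasure :=
    hi0.indicator hS
  have hi2 : Integrable (fun ω ↦ S.indicator (fun _ ↦ φ 0) ω) preWienerMeasure := (integrable_const _).indicator hS
  have hsplit : (fun ω ↦ S.indicator (fun ω ↦ φ (sleLifetimeReal κ θ ω)) ω) =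
      fun ω ↦ S.indicator (fun ω ↦ φ (sleLifetimeReal κ θ ω) - φ 0) ω + S.indicator (fun _ ↦ φ 0) ω := by
    funext ω
    by_cases hω : ω ∈ S
    · simp only [indicator_of_mem hω]; ring
    · simp only [indicator_of_notMem hω, add_zero]
  rw [hsplit, integral_add hi1 hi2, integral_indicator_const _ hS, smul_eq_mul]
  have h1 : |∫ ω, S.indicator (fun ω ↦ φ (sleLifetimeReal κ θ ω) - φ 0) ω ∂preWienerMeasure| ≤
      ∫ ω, |φ (sleLifetimeReal κ θ ω) - φ 0| ∂preWienerMeasure := by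
    refine abs_integral_le_integral_abs.trans (integral_mono_of_nonneg (Eventually.of_forall fun _ ↦ abs_nonneg _)
      hi0.abs (Eventually.of_forall fun ω ↦ ?_))
    by_cases hω : ω ∈ S
    · simp only [indicator_of_mem hω]; exact le_rfl
    · simp only [indicator_of_notMem hω, abs_zero]; exact abs_nonneg _
  have h2 : |preWienerMeasure.real S * φ 0 - φ 0| = |φ 0| * (1 - preWienerMeasure.real S) := by
    rw [show preWienerMeasure.real S * φ 0 - φ 0 = -(φ 0 * (1 - preWienerMeasure.real S)) by ring, abs_neg, abs_mul,
      abs_of_nonneg (sub_nonneg.2 measureReal_le_one)]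
  have heq : (∫ ω, S.indicator (fun ω ↦ φ (sleLifetimeReal κ θ ω) - φ 0) ω ∂preWienerMeasure) +
      preWienerMeasure.real S * φ 0 - φ 0 =
      (∫ ω, S.indicator (fun ω ↦ φ (sleLifetimeReal κ θ ω) - φ 0) ω ∂preWienerMeasure) +
        (preWienerMeasure.real S * φ 0 - φ 0) := by ring
  rw [heq]
  exact (abs_add_le _ _).trans (add_le_add h1 h2.le)

omit hκ in
/-- **The generic boundary limit**: along a filter `l` on `(0, 2π)` along which `P[η < T] → 0` for
every `η > 0` and `P[S_θ] → 1`, `E^θ[φ(T); S_θ] → φ(0)` for bounded continuous `φ`. [folklore] -/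
theorem tendsto_integral_indicator_of_tendsto {l : Filter ℝ} {S : ℝ → Set (ℝ≥0 → ℝ)}
    (hS : ∀ θ, MeasurableSet (S θ)) (hS1 : Tendsto (fun θ ↦ 1 - preWienerMeasure.real (S θ)) l (𝓝 0))
    (hT : ∀ η : ℝ≥0, 0 < η → Tendsto (fun θ ↦ preWienerMeasure.real {ω | (η : WithTop ℝ≥0) < sleLifetime κ θ ω}) l (𝓝 0))
    {φ : ℝ → ℝ} (hφc : Continuous φ) {C : ℝ} (hφb : ∀ t, |φ t| ≤ C) :
    Tendsto (fun θ ↦ ∫ ω, (S θ).indicator (fun ω ↦ φ (sleLifetimeReal κ θ ω)) ω ∂preWienerMeasure) l (𝓝 (φ 0)) := by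
  have hC : 0 ≤ C := (abs_nonneg _).trans (hφb 0)
  rw [Metric.tendsto_nhds]
  intro ε hε
  -- continuity of `φ` at `0`
  obtain ⟨δ, hδ, hδφ⟩ := Metric.continuousAt_iff.1 (hφc.continuousAt (x := 0)) (ε / 4) (by positivity)
  set η : ℝ≥0 := ⟨δ / 2, by positivity⟩ with hη
  have hη0 : 0 < η := by rw [hη, ← NNReal.coe_pos]; change 0 < δ / 2; positivity
  have hw : ∀ t ∈ Icc (0 : ℝ) η, |φ t - φ 0| ≤ ε / 4 := by
    intro t ht
    have : dist t 0 < δ := by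
      rw [Real.dist_eq, sub_zero, abs_of_nonneg ht.1]
      exact lt_of_le_of_lt ht.2 (by change δ / 2 < δ; linarith)
    exact (hδφ this).le
  have h1 := (hT η hη0).eventually (gt_mem_nhds (show (0 : ℝ) < ε / (4 * (2 * C + 1)) by positivity))
  have h2 := hS1.eventually (gt_mem_nhds (show (0 : ℝ) < ε / (4 * (|φ 0| + 1)) by positivity))
  filter_upwards [h1, h2] with θ hθ1 hθ2
  rw [Real.dist_eq]
  have hA := abs_integral_indicator_comp_sub_le (κ := κ) (hS θ) hφc.measurable hφb θ
  have hB := integral_abs_comp_sub_apply_zero_le (κ := κ) hφb (η := η) (by positivity) hw θ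
  have hP0 : 0 ≤ preWienerMeasure.real {ω | (η : WithTop ℝ≥0) < sleLifetime κ θ ω} := measureReal_nonneg
  have hQ0 : 0 ≤ 1 - preWienerMeasure.real (S θ) := by
    haveI := isProbabilityMeasure_preWienerMeasure'; exact sub_nonneg.2 measureReal_le_one
  have hx : 2 * C * preWienerMeasure.real {ω | (η : WithTop ℝ≥0) < sleLifetime κ θ ω} < ε / 4 := by
    calc 2 * C * _ ≤ (2 * C + 1) * preWienerMeasure.real {ω | (η : WithTop ℝ≥0) < sleLifetime κ θ ω} :=
          mul_le_mul_of_nonneg_right (by linarith) hP0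
      _ < (2 * C + 1) * (ε / (4 * (2 * C + 1))) := mul_lt_mul_of_pos_left hθ1 (by positivity)
      _ = ε / 4 := by field_simp
  have hy : |φ 0| * (1 - preWienerMeasure.real (S θ)) < ε / 4 := by
    calc |φ 0| * _ ≤ (|φ 0| + 1) * (1 - preWienerMeasure.real (S θ)) := mul_le_mul_of_nonneg_right (by linarith) hQ0
      _ < (|φ 0| + 1) * (ε / (4 * (|φ 0| + 1))) := mul_lt_mul_of_pos_left hθ2 (by positivity)
      _ = ε / 4 := by field_simp
  linarith

/-- `P^θ[η < T] → 0` as `θ ↓ 0`. [folklore] -/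
theorem tendsto_measureReal_lt_sleLifetime_nhdsGT_zero {η : ℝ≥0} (hη : 0 < η) :
    Tendsto (fun θ ↦ preWienerMeasure.real {ω | (η : WithTop ℝ≥0) < sleLifetime κ θ ω}) (𝓝[>] 0) (𝓝 0) := by
  have hp := lyapExp_pos hκ
  have hc := lyapConst_pos hκ
  have hpow : Tendsto (fun θ : ℝ ↦ θ ^ lyapExp κ / (lyapConst κ * η)) (𝓝[>] 0) (𝓝 0) := by
    have h0 : Tendsto (fun θ : ℝ ↦ θ ^ lyapExp κ) (𝓝 (0 : ℝ)) (𝓝 0) := by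
      have := (Real.continuousAt_rpow_const 0 (lyapExp κ) (Or.inr hp.le)).tendsto
      rwa [Real.zero_rpow hp.ne'] at this
    simpa using (h0.mono_left nhdsWithin_le_nhds).div_const (lyapConst κ * η)
  refine squeeze_zero' (Eventually.of_forall fun _ ↦ measureReal_nonneg) ?_ hpow
  filter_upwards [Ioo_mem_nhdsGT_zero hκ] with θ hθ
  exact measureReal_lt_sleLifetime_le_rpow hκ hθ hη

/-- `P^θ[η < T] → 0` as `θ ↑ 2π`. [folklore] -/
theorem tendsto_measureReal_lt_sleLifetime_nhdsLT_two_pi {η : ℝ≥0} (hη : 0 < η) :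
    Tendsto (fun θ ↦ preWienerMeasure.real {ω | (η : WithTop ℝ≥0) < sleLifetime κ θ ω}) (𝓝[<] (2 * Real.pi)) (𝓝 0) := by
  have hp := lyapExp_pos hκ
  have hc := lyapConst_pos hκ
  have hpow : Tendsto (fun θ : ℝ ↦ (2 * Real.pi - θ) ^ lyapExp κ / (lyapConst κ * η)) (𝓝[<] (2 * Real.pi)) (𝓝 0) := by
    have h0 : Tendsto (fun x : ℝ ↦ x ^ lyapExp κ) (𝓝 (0 : ℝ)) (𝓝 0) := by
      have := (Real.continuousAt_rpow_const 0 (lyapExp κ) (Or.inr hp.le)).tendsto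
      rwa [Real.zero_rpow hp.ne'] at this
    have hsub : Tendsto (fun θ : ℝ ↦ 2 * Real.pi - θ) (𝓝 (2 * Real.pi)) (𝓝 0) := by
      have h := (tendsto_const_nhds (x := 2 * Real.pi) (f := (𝓝 (2 * Real.pi)))).sub tendsto_id
      rwa [sub_self] at h
    simpa using ((h0.comp hsub).mono_left nhdsWithin_le_nhds).div_const (lyapConst κ * η)
  refine squeeze_zero' (Eventually.of_forall fun _ ↦ measureReal_nonneg) ?_ hpow
  filter_upwards [Ioo_mem_nhdsLT_two_pi hκ] with θ hθ
  exact measureReal_lt_sleLifetime_le_two_pi_sub_rpow hκ hθ hη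

/-- **`a_φ(θ) = E^θ[φ(T); Y_T = 2π] → 0` as `θ ↓ 0`.** [folklore] -/
theorem tendsto_topExpect_nhdsGT_zero {φ : ℝ → ℝ} {C : ℝ} (hφb : ∀ t, |φ t| ≤ C) :
    Tendsto (topExpect κ φ) (𝓝[>] 0) (𝓝 0) := by
  have hC : 0 ≤ C := (abs_nonneg _).trans (hφb 0)
  have h := (tendsto_measureReal_sleExitsTop_nhdsGT_zero hκ).const_mul C
  rw [mul_zero] at h
  refine squeeze_zero_norm' (Eventually.of_forall fun θ ↦ ?_) h
  rw [Real.norm_eq_abs]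
  exact abs_integral_indicator_comp_le (measurableSet_sleExitsTop κ θ) hφb θ

/-- **`b_φ(θ) = E^θ[φ(T); Y_T = 0] → φ(0)` as `θ ↓ 0`.** [folklore] -/
theorem tendsto_botExpect_nhdsGT_zero {φ : ℝ → ℝ} (hφc : Continuous φ) {C : ℝ} (hφb : ∀ t, |φ t| ≤ C) :
    Tendsto (botExpect κ φ) (𝓝[>] 0) (𝓝 (φ 0)) := by
  refine tendsto_integral_indicator_of_tendsto (S := fun θ ↦ sleExitsBot κ θ) (measurableSet_sleExitsBot κ) ?_
    (fun η hη ↦ tendsto_measureReal_lt_sleLifetime_nhdsGT_zero hκ hη) hφc hφb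
  refine (tendsto_measureReal_sleExitsTop_nhdsGT_zero hκ).congr' ?_
  filter_upwards [Ioo_mem_nhdsGT_zero hκ] with θ hθ
  have h := measureReal_sleExitsTop_add_sleExitsBot hκ hθ
  linarith

/-- **`b_φ(θ) → 0` as `θ ↑ 2π`.** [folklore] -/
theorem tendsto_botExpect_nhdsLT_two_pi {φ : ℝ → ℝ} {C : ℝ} (hφb : ∀ t, |φ t| ≤ C) :
    Tendsto (botExpect κ φ) (𝓝[<] (2 * Real.pi)) (𝓝 0) := by
  have hC : 0 ≤ C := (abs_nonneg _).trans (hφb 0)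
  have h := (tendsto_measureReal_sleExitsBot_nhdsLT_two_pi hκ).const_mul C
  rw [mul_zero] at h
  refine squeeze_zero_norm' (Eventually.of_forall fun θ ↦ ?_) h
  rw [Real.norm_eq_abs]
  exact abs_integral_indicator_comp_le (measurableSet_sleExitsBot κ θ) hφb θ

/-- **`a_φ(θ) → φ(0)` as `θ ↑ 2π`.** [folklore] -/
theorem tendsto_topExpect_nhdsLT_two_pi {φ : ℝ → ℝ} (hφc : Continuous φ) {C : ℝ} (hφb : ∀ t, |φ t| ≤ C) :
    Tendsto (topExpect κ φ) (𝓝[<] (2 * Real.pi)) (𝓝 (φ 0)) := by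
  refine tendsto_integral_indicator_of_tendsto (S := fun θ ↦ sleExitsTop κ θ) (measurableSet_sleExitsTop κ) ?_
    (fun η hη ↦ tendsto_measureReal_lt_sleLifetime_nhdsLT_two_pi hκ hη) hφc hφb
  refine (tendsto_measureReal_sleExitsBot_nhdsLT_two_pi hκ).congr' ?_
  filter_upwards [Ioo_mem_nhdsLT_two_pi hκ] with θ hθ
  have h := measureReal_sleExitsTop_add_sleExitsBot hκ hθ
  linarith

end BoundaryValues

end RadialLoewner

end Literature.Probability.RandomPlanarGeometry
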